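import Literature.AnabelianGeometry.EtaleTheta.Discharge.Sec3HQOfRationalSupport
import Literature.AnabelianGeometry.EtaleTheta.Discharge.Sec3Cor38CriterionCoordWeak
import Literature.AnabelianGeometry.EtaleTheta.Discharge.Sec3ConstantLineOfRlfWeak
import Literature.AnabelianGeometry.EtaleTheta.DivisorMonoidsConstants34
import HarnessLib

/-!
# [EtTh] Cor. 3.8 proof, row C38-L05 at the WEAK vocabulary: the side condition `hQ` DERIVED from `Φ₀`-level
# print statements (weakly perf-factorial `Φ₀(Y)`, `Φ(W)`), and the criterion at `ofRlfZWeak` / `ofRlfQWeak`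
# modulo `B₀`/`Φ₀`-level statements only

S. Mochizuki, *The étale theta function …*, Publ. RIMS **45** (2009) [MochizukiEtTh2009], proof of Cor. 3.8,
PDF p.81 l.20–27 (the base-field-theoretic pre-step criterion); Def. 3.6 (i)–(ii) pp.76–77; Prop. 3.4 (ii) p.74;
Remark 3.3.1 p.73 ("`Φ₀(Y)_𝔭 ≅ ℤ_{≥0}`"); [FrdI] §0 p.10 (monoid types), Def. 2.4 (i) pp.47–48 [MochizukiFrdI2008].

WEAK-VOCABULARY TWIN of §§2–4 of abc-iut-w5-d130's `Discharge/Sec3HQOfRationalSupport.lean` (row «hQ-FROM-Φ₀»,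
p433386; GAP G-w4d084-3) and of its knit `Discharge/Sec3Cor38CriterionCoordOfRlf.lean`.  §1 there (a monoid with
rational coordinates receives no embedding of `ℝ_{≥0}`: `HQRatCoord.not_injective_of_ratCoord`,
`not_isRMonoprime_of_embedding`) is vocabulary-free and consumed BY NAME.  What changes: "perf-factorial" is read
as abc-iut-L2-d2's `IsPerfFactorialWeak` ([FrdI] Def. 2.4 (i) (a)(b)(c) + (d_ord) + (d_res) — the notion satisfiable
at `Φ₀(Y^log) ⊇ ∏_J ℤ_{≥0}` for the coverings `Ÿ`, `Z_∞` with infinitely many special-fibre components, where the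
printed (d) fails: cell finding F-L2d2-1), using abc-iut-w4-d084's weak coordinate package
`Cor38Coord.exists_pfCoord_weak`, abc-iut-L6-t12's `IsPerfFactorialWeak.Rlf.toRealification_injective` and
`IsPerfFactorialWeak.Rlf.isPerfect`:

* §A `HQRatCoord.isZQMonoprime_primes_of_embedding_weak`, `isQMonoprime_pfAt_of_embedding_weak`,
  `isQMonoprime_pfAt_of_embedding_perfection_weak(′)`, `rlf_pow_injective_weak`,
  `exists_embedding_perfection_of_ratSupport_weak`, `isQMonoprime_pfAt_of_ratSupport_weak(′)`;
* §B at a tempered Frobenioid over ANY `T' : RealifiedDivisorMonoids treeMonoidVocabWeak`: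
  `isQMonoprime_pfAt_divisorMonoid_of_ratSupport_weak(_of_pfAt)` — **`hQ` of row C38-L05 DERIVED from (hZQ) "every
  prime of `Φ₀(Y_W)` is a `ℤ`- or `ℚ`-prime" and (hsat) "`Φ(W)` has rational support in `Φ₀^ℝ(Y_W)`"**, and
  `bsFldPreStepLimitCriterion_of_ratSupport_weak` = abc-iut-w4-d084's `bsFldPreStepLimitCriterion_of_coordWeak` with
  `hQ` so replaced;
* §C the knit at abc-iut-L6-t12's weak constructors: `hQ_ofRlf{Z,Q}Weak_of_ratSupport`,
  **`bsFldPreStepLimitCriterion_ofRlf{Z,Q}Weak_of_ratSupport`** ⇐ {`hF`, `dm.Prop34`, `hcyc`, `hZQ`, `hsat`} and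
  `…_of_prop34Const` ⇐ {`hF`, `dm.Prop34`, `dm.Prop34Const`, `hZQ`, `hsat`} — row C38-L05 at the `Ÿ` / `Z_∞`-type
  data modulo statements about the Def. 3.3 (iii) data and the containment `Φ ⊆ Φ₀^ℚ` ALONE.
Seat abc-iut-L6-t12 (gen 4), cell abc-iut, row «§3 WEAK COLUMN at Λ = ℚ/ℝ» piece (W7).  PROOF-ONLY (0 defs).
HONEST FRAMING: refereed pre-IUT material ([EtTh] §3 / [FrdI] §0, §2); nothing here bears on [IUTchIII] Cor. 3.12;
no statement of print is strengthened — (hsat)/(hZQ)/(hcyc) are print's situation for the geometric data and NOT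
derivable from the typed interfaces; typed ≠ proved.
-/

noncomputable section

namespace Literature.AnabelianGeometry.EtaleTheta

open CategoryTheory Opposite Function NNReal Literature.AlgebraicGeometry.Frobenioids

universe u₀ v₀ u v w

/-! ### §A Weakly perf-factorial monoids embedding into a monoid with rational coordinates -/

namespace HQRatCoord

section Embedding

variable {S : Type*} {P : Type*} [CommMonoid S] [CommMonoid P] {I : Type*}

/-- **The primes of a WEAKLY perf-factorial monoid embedding into a monoid with rational coordinates are `ℤ`- or
`ℚ`-primes** (each `S_𝔭` is monoprime, [FrdI] Def. 2.4 (i)(b), and not of type `ℝ` by the vocabulary-free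
`not_isRMonoprime_of_embedding`). [cite: MochizukiFrdI2008, Def. 2.4(i) p.47] -/
theorem isZQMonoprime_primes_of_embedding_weak (hS : IsPerfFactorialWeak S)
    (κ : P →* (I → Multiplicative ℝ≥0)) (hκ : Injective κ)
    (hrat : ∀ i, ∃ c : ℝ≥0, c ≠ 0 ∧ ∀ a : P, ∃ q : ℚ≥0, Multiplicative.toAdd (κ a i) = c * (q : ℝ≥0))
    (j : S →* P) (hj : Injective j) (𝔭 : Primes S) :
    IsZMonoprime ↥𝔭.submonoid ∨ IsQMonoprime ↥𝔭.submonoid := by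
  rcases hS.isMonoprime 𝔭 with hZ | hQ | hR
  · exact Or.inl hZ
  · exact Or.inr hQ
  · exact absurd hR (not_isRMonoprime_of_embedding κ hκ hrat (j.comp 𝔭.submonoid.subtype)
      (hj.comp Subtype.val_injective))

/-- **Every localized perfection `S^pf_𝔮` of a WEAKLY perf-factorial monoid embedding into a monoid with rational
coordinates is `ℚ`-monoprime.** [cite: MochizukiFrdI2008, Def. 2.4(i) p.47] -/
theorem isQMonoprime_pfAt_of_embedding_weak (hS : IsPerfFactorialWeak S)
    (κ : P →* (I → Multiplicative ℝ≥0)) (hκ : Injective κ)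
    (hrat : ∀ i, ∃ c : ℝ≥0, c ≠ 0 ∧ ∀ a : P, ∃ q : ℚ≥0, Multiplicative.toAdd (κ a i) = c * (q : ℝ≥0))
    (j : S →* P) (hj : Injective j) (𝔮 : Primes (Perfection S)) : IsQMonoprime (PfAt S 𝔮) :=
  RealifiedDivisorMonoids.Prop34Cnst.isQMonoprime_pfAt_of_forall hS.isDivisorial.isSharp
    (isZQMonoprime_primes_of_embedding_weak hS κ hκ hrat j hj) 𝔮

end Embedding

section Perfection

variable {M₀ : Type w} {S : Type w} [CommMonoid M₀] [CommMonoid S]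

/-- **`hQ` is inherited along embeddings into `M₀^pf`, weak form**: if `M₀` is WEAKLY perf-factorial with
`ℚ`-monoprime localized perfections `M₀^pf_𝔮` (its coordinates are then rational, abc-iut-w4-d084's
`Cor38Coord.exists_pfCoord_weak`), every weakly perf-factorial monoid `S` embedding into `M₀^pf` has
`ℚ`-monoprime localized perfections. [cite: MochizukiFrdI2008, Def. 2.4(i) p.47] -/
theorem isQMonoprime_pfAt_of_embedding_perfection_weak (h₀ : IsPerfFactorialWeak M₀)
    (hQ₀ : ∀ 𝔮 : Primes (Perfection M₀), IsQMonoprime (PfAt M₀ 𝔮)) (hS : IsPerfFactorialWeak S)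
    (j : S →* Perfection M₀) (hj : Injective j) (𝔮 : Primes (Perfection S)) : IsQMonoprime (PfAt S 𝔮) := by
  obtain ⟨κ, hκ, -, hrat⟩ := Cor38Coord.exists_pfCoord_weak h₀
  exact isQMonoprime_pfAt_of_embedding_weak hS κ hκ (fun 𝔮' => hrat 𝔮' (hQ₀ 𝔮')) j hj 𝔮

/-- The same from print's form of the hypothesis on `M₀`: every `M₀,𝔭` is `ℤ`-monoprime (or `ℚ`-monoprime)
([EtTh] Remark 3.3.1: `Φ₀(Y)_𝔭 ≅ ℤ_{≥0}`). [cite: MochizukiEtTh2009, Rmk 3.3.1 p.73] -/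
theorem isQMonoprime_pfAt_of_embedding_perfection_weak' (h₀ : IsPerfFactorialWeak M₀)
    (hZQ : ∀ 𝔭 : Primes M₀, IsZMonoprime ↥𝔭.submonoid ∨ IsQMonoprime ↥𝔭.submonoid) (hS : IsPerfFactorialWeak S)
    (j : S →* Perfection M₀) (hj : Injective j) (𝔮 : Primes (Perfection S)) : IsQMonoprime (PfAt S 𝔮) :=
  isQMonoprime_pfAt_of_embedding_perfection_weak h₀
    (RealifiedDivisorMonoids.Prop34Cnst.isQMonoprime_pfAt_of_forall h₀.isDivisorial.isSharp hZQ) hS j hj 𝔮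

/-- `N`-th powers are injective on the WEAK realification `M₀^rlf` (it is perfect,
`IsPerfFactorialWeak.Rlf.isPerfect`). [cite: MochizukiFrdI2008, Def. 2.4(i) p.48] -/
theorem rlf_pow_injective_weak (h₀ : IsPerfFactorialWeak M₀) {N : ℕ} (hN : 0 < N) :
    Injective fun x : h₀.Rlf => x ^ N :=
  ((IsPerfFactorialWeak.Rlf.isPerfect h₀).bijective_pow N hN).1

/-- **From rational support to an embedding into `M₀^pf`, weak form.**  If `ι : S ↪ M₀^rlf` is an injective
homomorphism such that every `ι x` has a power `(ι x)^N`, `N ≥ 1`, in the image of `M₀ → M₀^rlf`, then `S` embeds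
into `M₀^pf` compatibly with `M₀^pf → M₀^rlf` (injective for WEAKLY perf-factorial `M₀`:
`IsPerfFactorialWeak.Rlf.toRealification_injective`; `M₀^rlf` uniquely divisible). [cite: MochizukiFrdI2008, Def. 2.4(i) p.48] -/
theorem exists_embedding_perfection_of_ratSupport_weak (h₀ : IsPerfFactorialWeak M₀) (ι : S →* h₀.Rlf)
    (hι : Injective ι)
    (hsat : ∀ x : S, ∃ (N : ℕ+) (d : M₀), ι x ^ (N : ℕ) = h₀.toRealification (Perfection.of M₀ d)) :
    ∃ j : S →* Perfection M₀, Injective j ∧ ∀ x : S, h₀.toRealification (j x) = ι x := by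
  have hsat' : ∀ x : S, ∃ a : Perfection M₀, h₀.toRealification a = ι x := by
    intro x
    obtain ⟨N, d, hd⟩ := hsat x
    refine ⟨Perfection.mk d N, rlf_pow_injective_weak h₀ N.pos ?_⟩
    change h₀.toRealification (Perfection.mk d N) ^ (N : ℕ) = ι x ^ (N : ℕ)
    rw [← map_pow, Perfection.mk_pow_self, hd]
  choose a ha using hsat'
  have hinj : Injective h₀.toRealification := IsPerfFactorialWeak.Rlf.toRealification_injective h₀
  refine ⟨{ toFun := a, map_one' := hinj (by rw [ha, map_one, map_one]),
             map_mul' := fun x y => hinj (by rw [ha, map_mul, map_mul, ha, ha]) }, ?_, fun x => ha x⟩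
  intro x y hxy
  apply hι
  rw [← ha x, ← ha y]
  exact congrArg h₀.toRealification hxy

/-- **`hQ` for weakly perf-factorial submonoids of `M₀^rlf` with rational support** (weak `M₀`): if every
`M₀^pf_𝔮` is `ℚ`-monoprime and `S ↪ M₀^rlf` has every element with a power in the image of `M₀`, then every
`S^pf_𝔮` is `ℚ`-monoprime. [cite: MochizukiFrdI2008, Def. 2.4(i) p.47] -/
theorem isQMonoprime_pfAt_of_ratSupport_weak (h₀ : IsPerfFactorialWeak M₀)
    (hQ₀ : ∀ 𝔮 : Primes (Perfection M₀), IsQMonoprime (PfAt M₀ 𝔮)) (hS : IsPerfFactorialWeak S)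
    (ι : S →* h₀.Rlf) (hι : Injective ι)
    (hsat : ∀ x : S, ∃ (N : ℕ+) (d : M₀), ι x ^ (N : ℕ) = h₀.toRealification (Perfection.of M₀ d))
    (𝔮 : Primes (Perfection S)) : IsQMonoprime (PfAt S 𝔮) := by
  obtain ⟨j, hj, -⟩ := exists_embedding_perfection_of_ratSupport_weak h₀ ι hι hsat
  exact isQMonoprime_pfAt_of_embedding_perfection_weak h₀ hQ₀ hS j hj 𝔮

/-- The same from print's form of the hypothesis on `M₀` (every `M₀,𝔭` a `ℤ`- or `ℚ`-prime, [EtTh] Remark 3.3.1).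
[cite: MochizukiEtTh2009, Rmk 3.3.1 p.73] -/
theorem isQMonoprime_pfAt_of_ratSupport_weak' (h₀ : IsPerfFactorialWeak M₀)
    (hZQ : ∀ 𝔭 : Primes M₀, IsZMonoprime ↥𝔭.submonoid ∨ IsQMonoprime ↥𝔭.submonoid) (hS : IsPerfFactorialWeak S)
    (ι : S →* h₀.Rlf) (hι : Injective ι)
    (hsat : ∀ x : S, ∃ (N : ℕ+) (d : M₀), ι x ^ (N : ℕ) = h₀.toRealification (Perfection.of M₀ d))
    (𝔮 : Primes (Perfection S)) : IsQMonoprime (PfAt S 𝔮) :=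
  isQMonoprime_pfAt_of_ratSupport_weak h₀
    (RealifiedDivisorMonoids.Prop34Cnst.isQMonoprime_pfAt_of_forall h₀.isDivisorial.isSharp hZQ) hS ι hι hsat 𝔮

end Perfection

end HQRatCoord

/-! ### §B Tempered Frobenioids at the WEAK tree vocabulary: `hQ` from `Φ₀(Y)` and the rational support of `Φ(W)`
(the weak data `T'`, `C` are bound IN each statement, so that no statement is textually its strong twin) -/

variable {D₀ : Type u₀} [Category.{v₀} D₀] {D : Type u} [Category.{v} D] {VD : FrdICatStub.{u, v, w} D}

namespace TemperedFrobenioid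

section WeakVocab

/-- **`hQ` DERIVED** (weak tree vocabulary).  If every localized perfection `Φ₀(Y_W)^pf_𝔮₀` is `ℚ`-monoprime and
the divisor monoid `Φ(W) ⊆ Φ^{ℝ-log}(W) = Φ₀^ℝ(Y_W)` has rational support — every `x ∈ Φ(W)` has a power `x^N`,
`N ≥ 1`, in the image of `Φ₀(Y_W) → Φ₀^ℝ(Y_W)` (Def. 3.6 (i)/(ii) for monoid type `Λ ∈ {ℤ, ℚ}`) — then every
localized perfection `Φ(W)^pf_𝔮` is `ℚ`-monoprime. [cite: MochizukiEtTh2009, Def 3.6 p.76] -/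
theorem isQMonoprime_pfAt_divisorMonoid_of_ratSupport_weak_of_pfAt
    {T' : RealifiedDivisorMonoids (D₀ := D₀) treeMonoidVocabWeak.{w}} {C : TemperedFrobenioid T' D VD} (W : D)
    (hQ₀ : ∀ 𝔮₀ : Primes (Perfection (T'.Φ₀.obj (C.baseOp (op W)))),
      IsQMonoprime (PfAt (T'.Φ₀.obj (C.baseOp (op W))) 𝔮₀))
    (hsat : ∀ x ∈ C.Φ.carrier (op W), ∃ (N : ℕ+) (d : T'.Φ₀.obj (C.baseOp (op W))),
      x ^ (N : ℕ) = T'.toR (C.baseOp (op W)) d)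
    (𝔮 : Primes (Perfection (C.divisorMonoid.obj (op W)))) :
    IsQMonoprime (PfAt (C.divisorMonoid.obj (op W)) 𝔮) := by
  obtain ⟨h₀, e, he⟩ := (T'.isRealification (C.baseOp (op W)) : IsRealificationViaWeak _ _ _)
  let ι : (C.divisorMonoid.obj (op W)) →* h₀.Rlf := e.toMonoidHom.comp (C.Φ.carrier (op W)).subtype
  have hι : Injective ι := e.injective.comp Subtype.val_injective
  refine HQRatCoord.isQMonoprime_pfAt_of_ratSupport_weak h₀ hQ₀ (isPerfFactorialWeak_divisorMonoid W)
    ι hι (fun x : C.Φ.carrier (op W) => ?_) 𝔮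
  obtain ⟨N, d, hd⟩ := hsat (x : T'.ΦR.obj (C.baseOp (op W))) x.2
  refine ⟨N, d, ?_⟩
  change e ((x : T'.ΦR.obj (C.baseOp (op W)))) ^ (N : ℕ) = _
  rw [← map_pow, hd, he]

/-- **`hQ` DERIVED, print's form of the hypothesis on `Φ₀(Y_W)`** (weak tree vocabulary): every prime of
`Φ₀(Y_W)` is a `ℤ`- or a `ℚ`-prime ([EtTh] Remark 3.3.1) and `Φ(W)` has rational support in `Φ₀^ℝ(Y_W)`; then
every `Φ(W)^pf_𝔮` is `ℚ`-monoprime — the binder `hQ` of row C38-L05 (G-w4d084-3) at `W`.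
[cite: MochizukiEtTh2009, Def 3.6 p.76] -/
theorem isQMonoprime_pfAt_divisorMonoid_of_ratSupport_weak
    {T' : RealifiedDivisorMonoids (D₀ := D₀) treeMonoidVocabWeak.{w}} {C : TemperedFrobenioid T' D VD} (W : D)
    (hZQ : ∀ 𝔭 : Primes (T'.Φ₀.obj (C.baseOp (op W))),
      IsZMonoprime ↥𝔭.submonoid ∨ IsQMonoprime ↥𝔭.submonoid)
    (hsat : ∀ x ∈ C.Φ.carrier (op W), ∃ (N : ℕ+) (d : T'.Φ₀.obj (C.baseOp (op W))),
      x ^ (N : ℕ) = T'.toR (C.baseOp (op W)) d)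
    (𝔮 : Primes (Perfection (C.divisorMonoid.obj (op W)))) :
    IsQMonoprime (PfAt (C.divisorMonoid.obj (op W)) 𝔮) := by
  obtain ⟨h₀, -, -⟩ := (T'.isRealification (C.baseOp (op W)) : IsRealificationViaWeak _ _ _)
  exact isQMonoprime_pfAt_divisorMonoid_of_ratSupport_weak_of_pfAt W
    (RealifiedDivisorMonoids.Prop34Cnst.isQMonoprime_pfAt_of_forall h₀.isDivisorial.isSharp hZQ) hsat 𝔮

/-- **Row C38-L05 at the WEAK tree vocabulary with `hQ` REPLACED by data one level down**: abc-iut-w4-d084's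
`bsFldPreStepLimitCriterion_of_coordWeak` given `hF`, `hP34Λ`, `hNZ`, (hZQ) and (hsat) — `hQ` being a CONSEQUENCE
(`isQMonoprime_pfAt_divisorMonoid_of_ratSupport_weak`). [cite: MochizukiEtTh2009, Cor 3.8 p.81] -/
theorem bsFldPreStepLimitCriterion_of_ratSupport_weak
    {T' : RealifiedDivisorMonoids (D₀ := D₀) treeMonoidVocabWeak.{w}} (C : TemperedFrobenioid T' D VD)
    (hF : PreFrobenioid.IsFrobenioid C.toElem)
    (hP34Λ : ∀ (Y : D₀ᵒᵖ) (b : T'.BΛ.obj Y) (r : T'.ΦR.obj Y),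
      T'.divΛ Y b = Algebra.GrothendieckGroup.of r → b ∈ T'.FΛ Y)
    (hNZ : ∀ A : Dᵒᵖ, ∃ u : (T'.BΛ.obj (C.baseOp A) : Type w) × Algebra.GrothendieckGroup (C.Φ.carrier A),
      u ∈ C.cnstFn A ∧ ∃ Z : C.Φ.carrier A, Z ≠ 1 ∧ u.2 = Algebra.GrothendieckGroup.of Z)
    (hZQ : ∀ (W : D) (𝔭 : Primes (T'.Φ₀.obj (C.baseOp (op W)))),
      IsZMonoprime ↥𝔭.submonoid ∨ IsQMonoprime ↥𝔭.submonoid)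
    (hsat : ∀ (W : D), ∀ x ∈ C.Φ.carrier (op W), ∃ (N : ℕ+) (d : T'.Φ₀.obj (C.baseOp (op W))),
      x ^ (N : ℕ) = T'.toR (C.baseOp (op W)) d) :
    C.BsFldPreStepLimitCriterion (PreFrobenioidData.perfection hF) :=
  bsFldPreStepLimitCriterion_of_coordWeak C hF hP34Λ hNZ
    fun W 𝔮 => isQMonoprime_pfAt_divisorMonoid_of_ratSupport_weak W (hZQ W) (hsat W) 𝔮

end WeakVocab

/-! ### §C The knit at the weak constructed data `ofRlfZWeak` / `ofRlfQWeak` -/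

section OfRlfWeak

variable {D₀' : Type u} [Category.{v} D₀'] {dm : DivisorMonoids.{u, v, w} D₀'}
  {hpf : ∀ Y : D₀'ᵒᵖ, IsPerfFactorialCof (dm.Φ₀.obj Y)} {V : FrdIMonoidStub.{w}} {V₀ : FrdICatStub.{u, v, w} D₀'}
  {D' : Type u₀} [Category.{v₀} D'] {VD' : FrdICatStub.{u₀, v₀, w} D'}

/-- **`hQ` at the weak constructed data of monoid type `ℤ`**: for a tempered Frobenioid over `ofRlfZWeak dm hpf`, if
every prime of `Φ₀(Y_W)` is a `ℤ`- or a `ℚ`-prime and `Φ(W)` has rational support in `Φ₀(Y_W)^rlf` (weak), then every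
`Φ(W)^pf_𝔮` is `ℚ`-monoprime. [cite: MochizukiEtTh2009, Def 3.6 p.76] -/
theorem hQ_ofRlfZWeak_of_ratSupport
    (C₀ : TemperedFrobenioid (RealifiedDivisorMonoids.ofRlfZWeak dm hpf) D' VD') (W : D')
    (hZQ : ∀ 𝔭 : Primes (dm.Φ₀.obj (C₀.baseOp (op W))), IsZMonoprime ↥𝔭.submonoid ∨ IsQMonoprime ↥𝔭.submonoid)
    (hsat : ∀ x ∈ C₀.Φ.carrier (op W), ∃ (N : ℕ+) (d : dm.Φ₀.obj (C₀.baseOp (op W))),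
      x ^ (N : ℕ) = (hpf (C₀.baseOp (op W))).weak.toRealification (Perfection.of _ d))
    (𝔮 : Primes (Perfection (C₀.divisorMonoid.obj (op W)))) :
    IsQMonoprime (PfAt (C₀.divisorMonoid.obj (op W)) 𝔮) :=
  isQMonoprime_pfAt_divisorMonoid_of_ratSupport_weak W hZQ hsat 𝔮

/-- **Row C38-L05 over `ofRlfZWeak dm hpf` modulo `B₀`/`Φ₀`-level print statements only**: the base-field-theoretic
pre-step criterion for THE perfection of the Frobenioid `hF`, from `dm.Prop34` (Prop. 3.4), `hcyc` (divisors of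
constants are powers of one effective divisor), `hZQ` (primes of `Φ₀(Y)` of type `ℤ`/`ℚ`) and `hsat` (rational
support of `Φ`) — `hP34Λ`, `hNZ` (`Sec3ConstantLineOfRlfWeak`) and `hQ` (§B) being DERIVED.
[cite: MochizukiEtTh2009, Cor 3.8 p.81] -/
theorem bsFldPreStepLimitCriterion_ofRlfZWeak_of_ratSupport
    (C₀ : TemperedFrobenioid (RealifiedDivisorMonoids.ofRlfZWeak dm hpf) D' VD')
    (hF : PreFrobenioid.IsFrobenioid C₀.toElem) (h34 : dm.Prop34 V V₀)
    (hcyc : ∀ Y : D₀'ᵒᵖ, ∃ d : dm.Φ₀.obj Y, ∀ b ∈ dm.F₀ Y, ∃ n : ℤ,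
      dm.div₀ Y b = Algebra.GrothendieckGroup.of d ^ n)
    (hZQ : ∀ (W : D') (𝔭 : Primes (dm.Φ₀.obj (C₀.baseOp (op W)))),
      IsZMonoprime ↥𝔭.submonoid ∨ IsQMonoprime ↥𝔭.submonoid)
    (hsat : ∀ (W : D'), ∀ x ∈ C₀.Φ.carrier (op W), ∃ (N : ℕ+) (d : dm.Φ₀.obj (C₀.baseOp (op W))),
      x ^ (N : ℕ) = (hpf (C₀.baseOp (op W))).weak.toRealification (Perfection.of _ d)) :
    C₀.BsFldPreStepLimitCriterion (PreFrobenioidData.perfection hF) :=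
  bsFldPreStepLimitCriterion_of_ratSupport_weak C₀ hF
    (RealifiedDivisorMonoids.ofRlfZWeak_mem_FΛ_of_divΛ_eq_of dm hpf h34)
    (exists_cnstFn_effective_ofRlfZWeak C₀ h34 hcyc) hZQ hsat

/-- The same with `hcyc` read from abc-iut-L2-t3's binder of record `dm.Prop34Const`.
[cite: MochizukiEtTh2009, Cor 3.8 p.81] -/
theorem bsFldPreStepLimitCriterion_ofRlfZWeak_of_ratSupport_of_prop34Const
    (C₀ : TemperedFrobenioid (RealifiedDivisorMonoids.ofRlfZWeak dm hpf) D' VD')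
    (hF : PreFrobenioid.IsFrobenioid C₀.toElem) (h34 : dm.Prop34 V V₀) (hC : dm.Prop34Const)
    (hZQ : ∀ (W : D') (𝔭 : Primes (dm.Φ₀.obj (C₀.baseOp (op W)))),
      IsZMonoprime ↥𝔭.submonoid ∨ IsQMonoprime ↥𝔭.submonoid)
    (hsat : ∀ (W : D'), ∀ x ∈ C₀.Φ.carrier (op W), ∃ (N : ℕ+) (d : dm.Φ₀.obj (C₀.baseOp (op W))),
      x ^ (N : ℕ) = (hpf (C₀.baseOp (op W))).weak.toRealification (Perfection.of _ d)) :
    C₀.BsFldPreStepLimitCriterion (PreFrobenioidData.perfection hF) :=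
  bsFldPreStepLimitCriterion_ofRlfZWeak_of_ratSupport C₀ hF h34 hC.hcyc hZQ hsat

/-- **`hQ` at the weak constructed data of monoid type `ℚ`** (`B₀^ℚ = B₀^pf`, `F₀^ℚ = F₀^pf`, same weak `Φ₀^ℝ`).
[cite: MochizukiEtTh2009, Def 3.6 p.76] -/
theorem hQ_ofRlfQWeak_of_ratSupport
    (C₀ : TemperedFrobenioid (RealifiedDivisorMonoids.ofRlfQWeak dm hpf) D' VD') (W : D')
    (hZQ : ∀ 𝔭 : Primes (dm.Φ₀.obj (C₀.baseOp (op W))), IsZMonoprime ↥𝔭.submonoid ∨ IsQMonoprime ↥𝔭.submonoid)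
    (hsat : ∀ x ∈ C₀.Φ.carrier (op W), ∃ (N : ℕ+) (d : dm.Φ₀.obj (C₀.baseOp (op W))),
      x ^ (N : ℕ) = (hpf (C₀.baseOp (op W))).weak.toRealification (Perfection.of _ d))
    (𝔮 : Primes (Perfection (C₀.divisorMonoid.obj (op W)))) :
    IsQMonoprime (PfAt (C₀.divisorMonoid.obj (op W)) 𝔮) :=
  isQMonoprime_pfAt_divisorMonoid_of_ratSupport_weak W hZQ hsat 𝔮

/-- **Row C38-L05 over `ofRlfQWeak dm hpf` modulo `B₀`/`Φ₀`-level print statements only** (`hP34Λ` at `Λ = ℚ` from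
`dm.Prop34` by `Prop34Cnst.ofRlfQWeak_mem_FΛ_of_divΛ_eq_of'`, `hNZ` by `exists_cnstFn_effective_ofRlfQWeak`, `hQ` by
§B). [cite: MochizukiEtTh2009, Cor 3.8 p.81] -/
theorem bsFldPreStepLimitCriterion_ofRlfQWeak_of_ratSupport
    (C₀ : TemperedFrobenioid (RealifiedDivisorMonoids.ofRlfQWeak dm hpf) D' VD')
    (hF : PreFrobenioid.IsFrobenioid C₀.toElem) (h34 : dm.Prop34 V V₀)
    (hcyc : ∀ Y : D₀'ᵒᵖ, ∃ d : dm.Φ₀.obj Y, ∀ b ∈ dm.F₀ Y, ∃ n : ℤ,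
      dm.div₀ Y b = Algebra.GrothendieckGroup.of d ^ n)
    (hZQ : ∀ (W : D') (𝔭 : Primes (dm.Φ₀.obj (C₀.baseOp (op W)))),
      IsZMonoprime ↥𝔭.submonoid ∨ IsQMonoprime ↥𝔭.submonoid)
    (hsat : ∀ (W : D'), ∀ x ∈ C₀.Φ.carrier (op W), ∃ (N : ℕ+) (d : dm.Φ₀.obj (C₀.baseOp (op W))),
      x ^ (N : ℕ) = (hpf (C₀.baseOp (op W))).weak.toRealification (Perfection.of _ d)) :
    C₀.BsFldPreStepLimitCriterion (PreFrobenioidData.perfection hF) :=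
  bsFldPreStepLimitCriterion_of_ratSupport_weak C₀ hF
    (RealifiedDivisorMonoids.Prop34Cnst.ofRlfQWeak_mem_FΛ_of_divΛ_eq_of' h34)
    (exists_cnstFn_effective_ofRlfQWeak C₀ h34 hcyc) hZQ hsat

/-- The same with `hcyc` read from `dm.Prop34Const`. [cite: MochizukiEtTh2009, Cor 3.8 p.81] -/
theorem bsFldPreStepLimitCriterion_ofRlfQWeak_of_ratSupport_of_prop34Const
    (C₀ : TemperedFrobenioid (RealifiedDivisorMonoids.ofRlfQWeak dm hpf) D' VD')
    (hF : PreFrobenioid.IsFrobenioid C₀.toElem) (h34 : dm.Prop34 V V₀) (hC : dm.Prop34Const)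
    (hZQ : ∀ (W : D') (𝔭 : Primes (dm.Φ₀.obj (C₀.baseOp (op W)))),
      IsZMonoprime ↥𝔭.submonoid ∨ IsQMonoprime ↥𝔭.submonoid)
    (hsat : ∀ (W : D'), ∀ x ∈ C₀.Φ.carrier (op W), ∃ (N : ℕ+) (d : dm.Φ₀.obj (C₀.baseOp (op W))),
      x ^ (N : ℕ) = (hpf (C₀.baseOp (op W))).weak.toRealification (Perfection.of _ d)) :
    C₀.BsFldPreStepLimitCriterion (PreFrobenioidData.perfection hF) :=
  bsFldPreStepLimitCriterion_ofRlfQWeak_of_ratSupport C₀ hF h34 hC.hcyc hZQ hsat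

end OfRlfWeak

end TemperedFrobenioid

end Literature.AnabelianGeometry.EtaleTheta

end
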